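import Literature.Barriers.Parity.SiegelZeroDichotomyChowlaStep3EulerMajorant
import Literature.Barriers.Parity.SiegelZeroDichotomyChowlaMajorant
import Literature.Barriers.Parity.SiegelZeroDichotomyChowlaTools
import HarnessLib

/-!
# Tao–Teräväinen, Lemma 6.1 at `k = 0` — PROVED (`TaoTeravainen2021_lemma61_holds`)

Topic `Literature/Barriers/Parity`; the discharge of the named fact
`Literature.Barriers.Parity.TaoTeravainen2021_lemma61` (`SiegelZeroDichotomyChowlaMajorant.lean`),
step (iii) of the proof DAG of `Literature.Barriers.Parity.TaoTeravainen2021_chowla`.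

T. Tao, J. Teräväinen, *The Hardy–Littlewood–Chowla conjecture in the presence of a Siegel zero*
(arXiv:2109.06291), Lemma 6.1: "Let `x` be real with `2 ≤ x ≤ q^{V/2}`. We have
`|λ_Siegel(n) - λ♯_Siegel(n)| ≪ H(n)` for all `1 ≤ n ≤ x` where `H(n) := Σ_{d ≤ D: d ∣ n} α(d)` and
`α(d)` are non-negative reals … `Σ_{d ≤ D} τ(d)^A α(d)/d ≪_A exp(-⅛ log_R D)` for any `A ≥ 1`."
[cite: TaoTeravainen2021, Lemma 6.1 (with (6.1)–(6.6))]

The proof follows the source (§6): `λ♭_Siegel(n) = ∫ β_t(n) f(t) dt` ((6.11),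
`SiegelZeroDichotomyChowlaStep3Flat.lean`); `|β_t(n)| ≤ Σ_{d ∣ n, d ≤ D} v_t(d)` by the
prime-power bounds, Landreau's splitting and subadditivity
(`SiegelZeroDichotomyChowlaStep3PrimePow/Blocks/BetaMajorant.lean`); hence (6.4) with
`α(d) := ∫ v_t(d) |f(t)| dt` and `C = 1`; and (6.6) from the Euler product bound
`Σ_d τ(d)^A v_t(d)/d ≪_A (|s_t| log R)^{O_A(1)} ≪ (1+|t|)^{O_A(1)}`
(`SiegelZeroDichotomyChowlaStep3EulerMajorant.lean`, using (3.3)) and the decay (6.10) of `f`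
(`SiegelZeroDichotomyChowlaStep3Cutoff.lean`), which give `≪_A exp(-½ log_R D) ≤ exp(-⅛ log_R D)`.
The thresholds: with `L = log η`, `t = L^{1/5}`, `R = x^{1/t}`, `D = x^{ε₀/(10ℓ)}` and Siegel's
theorem (1.4) (`log q ≥ log η - c`), for `η ≥ η₁(ℓ, ε₀)` one has `log R ≥ 4P`, `R ≤ D`,
`log(⌊D⌋₊/⌊R⌋₊) ≥ (ε₀/(20ℓ)) log x - log 2` and `log(2x) ≤ (J-1) log(⌊D⌋₊/⌊R⌋₊)` with
`J = ⌈80ℓ/ε₀⌉₊ + 2`, `P = J 4^{J-1}`.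
-/

noncomputable section

open Finset Real MeasureTheory Complex

namespace Literature.Barriers.Parity.TaoTeravainen

variable {q : ℕ} (χ : DirichletCharacter ℂ q)

/-! ### Continuity in `s` and `t`; the size of `s_t` -/

/-- `s ↦ bExp s p k` is continuous. [folklore] -/
theorem continuous_bExp (p k : ℕ) : Continuous fun s : ℂ => bExp s p k := by
  unfold bExp
  split_ifs
  · exact continuous_const
  · exact Continuous.min (by fun_prop) (by fun_prop)

/-- `s ↦ vMaj s P N d` is continuous. [folklore] -/
theorem continuous_vMaj (P N d : ℕ) : Continuous fun s : ℂ => vMaj s P N d := by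
  unfold vMaj
  split_ifs
  · exact continuous_finsetProd _ fun p _ =>
      ((Real.continuous_exp.comp (continuous_const.mul (continuous_bExp p _))).sub continuous_const)
  · exact continuous_const

/-- `t ↦ s_t` is continuous. [folklore] -/
theorem continuous_sParam (R : ℝ) : Continuous fun t : ℝ => sParam R t := by
  unfold sParam; fun_prop

/-- `‖s_t‖ log R = ‖1 + 2πit‖` for `R > 1`. [folklore] -/
theorem norm_sParam_mul_log {R : ℝ} (hR : 1 < R) (t : ℝ) :
    ‖sParam R t‖ * Real.log R = ‖(1 : ℂ) + 2 * π * t * Complex.I‖ := by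
  have hlog : 0 < Real.log R := Real.log_pos hR
  unfold sParam
  rw [norm_div, Complex.norm_real, Real.norm_of_nonneg hlog.le, div_mul_cancel₀ _ hlog.ne']

/-- `1 ≤ ‖1 + 2πit‖ ≤ 7(1 + |t|)`. [folklore] -/
theorem one_le_norm_one_add_and (t : ℝ) :
    1 ≤ ‖(1 : ℂ) + 2 * π * t * Complex.I‖ ∧ ‖(1 : ℂ) + 2 * π * t * Complex.I‖ ≤ 7 * (1 + |t|) := by
  constructor
  · have h := Complex.abs_re_le_norm ((1 : ℂ) + 2 * π * t * Complex.I)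
    have hre : ((1 : ℂ) + 2 * π * t * Complex.I).re = 1 := by simp
    rw [hre, abs_one] at h
    exact h
  · have hpi : π ≤ 3.15 := Real.pi_lt_d2.le
    calc ‖(1 : ℂ) + 2 * π * t * Complex.I‖ ≤ ‖(1 : ℂ)‖ + ‖2 * (π : ℂ) * t * Complex.I‖ := norm_add_le _ _
      _ = 1 + 2 * π * |t| := by
          rw [norm_one, norm_mul, norm_mul, norm_mul, Complex.norm_I, mul_one, Complex.norm_real,
            Complex.norm_real, Real.norm_of_nonneg Real.pi_pos.le, Real.norm_eq_abs,
            Complex.norm_two]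
      _ ≤ 7 * (1 + |t|) := by nlinarith [abs_nonneg t, Real.pi_pos]

/-- The crude, `t`-independent bound `vMaj s P N d ≤ Π_{p ∣ d} exp(P (log(2k_p+1) + k_p (Re s) log p))`
(`Re s ≥ 0`). [folklore] -/
theorem vMaj_le_crude {s : ℂ} (hs : 0 ≤ s.re) (P N d : ℕ) :
    vMaj s P N d ≤ ∏ p ∈ d.primeFactors,
      Real.exp (P * (Real.log (2 * (d.factorization p) + 1) + (d.factorization p) * (s.re * Real.log p))) := by
  unfold vMaj
  split_ifs
  · refine Finset.prod_le_prod (fun p _ => ?_) fun p hp => ?_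
    · have : 0 ≤ (P : ℝ) * bExp s p (d.factorization p) := mul_nonneg (Nat.cast_nonneg _) (bExp_nonneg hs _ _)
      linarith [Real.add_one_le_exp ((P : ℝ) * bExp s p (d.factorization p))]
    · have hk : d.factorization p ≠ 0 := by
        rw [← Nat.support_factorization, Finsupp.mem_support_iff] at hp; exact hp
      have h1 := bExp_le_crude s p hk
      have h2 : Real.exp (P * bExp s p (d.factorization p)) ≤
          Real.exp (P * (Real.log (2 * (d.factorization p) + 1) + (d.factorization p) * (s.re * Real.log p))) :=
        Real.exp_le_exp.mpr (mul_le_mul_of_nonneg_left h1 (Nat.cast_nonneg _))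
      linarith
  · exact Finset.prod_nonneg fun p _ => (Real.exp_pos _).le

/-! ### The weights `α(d)` -/

/-- The weights of Lemma 6.1: `α(d) := ∫ v_{s_t}(d) |f(t)| dt` with `f` the Fourier transform of
`e^u(1 - ψ(κu))`, `κ = log R/log D` (the source's `α(d) := 1_(≤R)(d) ∫ Π_p (exp(O(a_{t,d_(p)}))-1) |f(t)| dt`,
the indicator being built into `vMaj`). [cite: TaoTeravainen2021, §6, proof of Lemma 6.1 (definition of `α(d)`)] -/
def alphaW (ψ : ℝ → ℝ) (R D : ℝ) (P d : ℕ) : ℝ :=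
  ∫ t : ℝ, vMaj (sParam R t) P (⌊R⌋₊ + 1) d * ‖cutoffFourier ψ (Real.log R / Real.log D) t‖

variable {ψ : ℝ → ℝ}

/-- Integrability of `t ↦ v_{s_t}(d) |f(t)|` (bounded continuous times integrable). [folklore] -/
theorem integrable_vMaj_mul (hψ : IsSmoothCutoff ψ) {R D : ℝ} (hR : 1 < R) (hRD : R ≤ D) (P d : ℕ) :
    Integrable fun t : ℝ => vMaj (sParam R t) P (⌊R⌋₊ + 1) d *
      ‖cutoffFourier ψ (Real.log R / Real.log D) t‖ := by
  have hlogR : 0 < Real.log R := Real.log_pos hR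
  have hlogD : 0 < Real.log D := Real.log_pos (by linarith)
  have hκ : 0 < Real.log R / Real.log D := div_pos hlogR hlogD
  have hκ1 : Real.log R / Real.log D ≤ 1 := (div_le_one hlogD).mpr (Real.log_le_log (by linarith) hRD)
  have hf : Integrable fun t : ℝ => ‖cutoffFourier ψ (Real.log R / Real.log D) t‖ :=
    (hψ.integrable_cutoffFourier hκ hκ1).norm
  -- the `t`-independent bound
  set V : ℝ := ∏ p ∈ d.primeFactors,
    Real.exp (P * (Real.log (2 * (d.factorization p) + 1) + (d.factorization p) * (1 / Real.log R * Real.log p)))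
    with hV
  have hmeas : AEStronglyMeasurable (fun t : ℝ => vMaj (sParam R t) P (⌊R⌋₊ + 1) d) volume :=
    ((continuous_vMaj P _ d).comp (continuous_sParam R)).aestronglyMeasurable
  refine hf.bdd_mul (c := V) hmeas (ae_of_all _ fun t => ?_)
  have hs : 0 ≤ (sParam R t).re := sParam_re_nonneg hR.le t
  rw [Real.norm_of_nonneg (vMaj_nonneg hs P _ d)]
  have h := vMaj_le_crude hs P (⌊R⌋₊ + 1) d
  rw [sParam_re] at h
  exact h

/-- `α(d) ≥ 0`. [cite: TaoTeravainen2021, Lemma 6.1 ("`α(d)` are non-negative reals")] -/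
theorem alphaW_nonneg (ψ : ℝ → ℝ) {R : ℝ} (hR : 1 ≤ R) (D : ℝ) (P d : ℕ) : 0 ≤ alphaW ψ R D P d :=
  integral_nonneg fun t => mul_nonneg (vMaj_nonneg (sParam_re_nonneg hR t) P _ d) (norm_nonneg _)

/-! ### (6.4) -/

/-- **(6.4) — PROVED**: `|λ♭_Siegel(n)| ≤ Σ_{d ∣ n, d ≤ ⌊D⌋} α(d)` for `n ≥ 1` with
`log n ≤ (J-1) log(⌊D⌋₊/⌊R⌋₊)` (`1 < R ≤ D`, `1 < ⌊D⌋₊/⌊R⌋₊`, `P = J 4^{J-1}`, quadratic `χ`).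
[cite: TaoTeravainen2021, Lemma 6.1 (6.4)] -/
theorem abs_liouvilleSiegelFlat_le_sum_alphaW (hχ : χ.IsQuadratic) (hψ : IsSmoothCutoff ψ)
    {R D : ℝ} (hR : 1 < R) (hRD : R ≤ D) {J : ℕ} (hJ : 1 ≤ J)
    (hDB : (1 : ℝ) < (⌊D⌋₊ : ℝ) / ⌊R⌋₊) {n : ℕ} (hn : n ≠ 0)
    (hlen : Real.log n ≤ ((J : ℝ) - 1) * Real.log ((⌊D⌋₊ : ℝ) / ⌊R⌋₊)) :
    |liouvilleSiegelFlat χ ψ R D n| ≤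
      ∑ d ∈ n.divisors.filter (· ≤ ⌊D⌋₊), alphaW ψ R D (J * 4 ^ (J - 1)) d := by
  have hBD : ⌊R⌋₊ ≤ ⌊D⌋₊ := Nat.floor_le_floor hRD
  have hlogR : 0 < Real.log R := Real.log_pos hR
  calc |liouvilleSiegelFlat χ ψ R D n|
      ≤ ∫ t : ℝ, ‖betaAF χ (⌊R⌋₊ + 1) (sParam R t) n‖ * ‖cutoffFourier ψ (Real.log R / Real.log D) t‖ :=
        abs_liouvilleSiegelFlat_le_integral χ hψ hR hRD n
    _ ≤ ∫ t : ℝ, ∑ d ∈ n.divisors.filter (· ≤ ⌊D⌋₊),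
          vMaj (sParam R t) (J * 4 ^ (J - 1)) (⌊R⌋₊ + 1) d * ‖cutoffFourier ψ (Real.log R / Real.log D) t‖ := by
        refine integral_mono (integrable_norm_betaAF_mul_norm χ hψ hR hRD n)
          (integrable_finsetSum _ fun d _ => integrable_vMaj_mul hψ hR hRD _ d) fun t => ?_
        dsimp only
        rw [← Finset.sum_mul]
        refine mul_le_mul_of_nonneg_right ?_ (norm_nonneg _)
        have hs : 0 ≤ (sParam R t).re := sParam_re_nonneg hR.le t
        have hsR : (sParam R t).re * Real.log R ≤ 1 := by
          rw [sParam_re, one_div, inv_mul_cancel₀ hlogR.ne']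
        exact norm_betaAF_le_sum_vMaj χ hχ hR.le hs hsR hJ hBD hDB hn hlen
    _ = ∑ d ∈ n.divisors.filter (· ≤ ⌊D⌋₊), alphaW ψ R D (J * 4 ^ (J - 1)) d :=
        integral_finsetSum _ fun d _ => integrable_vMaj_mul hψ hR hRD _ d

/-! ### (6.6) -/

/-- Integrability of `t ↦ (‖s_t‖ log R)^c |f(t)|` (`≤ 7^c (1+|t|)^{⌈c⌉} |f(t)|`). [folklore] -/
theorem integrable_normParam_rpow_mul (hψ : IsSmoothCutoff ψ) {R D : ℝ} (hR : 1 < R) (hRD : R ≤ D)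
    {c : ℝ} (hc : 0 ≤ c) :
    Integrable fun t : ℝ => (‖sParam R t‖ * Real.log R) ^ c *
      ‖cutoffFourier ψ (Real.log R / Real.log D) t‖ := by
  have hlogR : 0 < Real.log R := Real.log_pos hR
  have hlogD : 0 < Real.log D := Real.log_pos (by linarith)
  have hκ : 0 < Real.log R / Real.log D := div_pos hlogR hlogD
  have hκ1 : Real.log R / Real.log D ≤ 1 := (div_le_one hlogD).mpr (Real.log_le_log (by linarith) hRD)
  have hdom := (hψ.integrable_pow_mul_norm_cutoffFourier ⌈c⌉₊ hκ hκ1).const_mul ((7 : ℝ) ^ c)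
  refine hdom.mono' ?_ (ae_of_all _ fun t => ?_)
  · refine AEStronglyMeasurable.mul ?_ (hψ.integrable_cutoffFourier hκ hκ1).norm.aestronglyMeasurable
    refine (Continuous.rpow_const ?_ fun _ => Or.inr hc).aestronglyMeasurable
    exact ((continuous_sParam R).norm).mul continuous_const
  · have hT0 : 0 ≤ ‖sParam R t‖ * Real.log R := mul_nonneg (norm_nonneg _) hlogR.le
    rw [Real.norm_of_nonneg (mul_nonneg (Real.rpow_nonneg hT0 c) (norm_nonneg _))]
    obtain ⟨h1, h7⟩ := one_le_norm_one_add_and t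
    rw [norm_sParam_mul_log hR] at hT0 ⊢
    have ht1 : (1 : ℝ) ≤ 1 + |t| := by linarith [abs_nonneg t]
    have hpow : ‖(1 : ℂ) + 2 * π * t * Complex.I‖ ^ c ≤ (7 : ℝ) ^ c * (1 + |t|) ^ ⌈c⌉₊ := by
      calc ‖(1 : ℂ) + 2 * π * t * Complex.I‖ ^ c ≤ (7 * (1 + |t|)) ^ c :=
            Real.rpow_le_rpow (norm_nonneg _) h7 hc
        _ = (7 : ℝ) ^ c * (1 + |t|) ^ c := Real.mul_rpow (by norm_num) (by positivity)
        _ ≤ (7 : ℝ) ^ c * (1 + |t|) ^ ((⌈c⌉₊ : ℕ) : ℝ) := by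
            gcongr
            exact Nat.le_ceil c
        _ = (7 : ℝ) ^ c * (1 + |t|) ^ ⌈c⌉₊ := by rw [Real.rpow_natCast]
    calc ‖(1 : ℂ) + 2 * π * t * Complex.I‖ ^ c * ‖cutoffFourier ψ (Real.log R / Real.log D) t‖
        ≤ (7 : ℝ) ^ c * (1 + |t|) ^ ⌈c⌉₊ * ‖cutoffFourier ψ (Real.log R / Real.log D) t‖ :=
          mul_le_mul_of_nonneg_right hpow (norm_nonneg _)
      _ = (7 : ℝ) ^ c * ((1 + |t|) ^ ⌈c⌉₊ * ‖cutoffFourier ψ (Real.log R / Real.log D) t‖) := by ring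

/-- **(6.6) — PROVED** (for the weights `alphaW`): given the Euler-product data `K, c` of
`exists_sum_tau_rpow_mul_vMaj_div_le` (for `A` and `P`) and the decay constant `Cψ` of
`IsSmoothCutoff.integral_cutoffFourier_le ⌈c⌉₊`, for `2 ≤ R ≤ D` with `log R ≥ 4P`:
`Σ_{1 ≤ d ≤ ⌊D⌋} τ(d)^A α(d)/d ≤ K 7^c Cψ exp(-½ log D/log R)`.
[cite: TaoTeravainen2021, Lemma 6.1 (6.6) and §6, proof of (6.6)] -/
theorem sum_tau_rpow_mul_alphaW_div_le (hψ : IsSmoothCutoff ψ) {A : ℝ} {P : ℕ}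
    {K c : ℝ} (hK : 0 ≤ K) (hc : 0 ≤ c)
    (hF : ∀ R : ℝ, 2 ≤ R → ∀ s : ℂ, 0 ≤ s.re → s.re * Real.log R ≤ 1 →
      (P : ℝ) * s.re ≤ 1 / 4 → 1 ≤ ‖s‖ * Real.log R → ∀ D' : ℕ,
        ∑ d ∈ Icc 1 D', (#d.divisors : ℝ) ^ A * vMaj s P (⌊R⌋₊ + 1) d / d ≤ K * (‖s‖ * Real.log R) ^ c)
    {Cψ : ℝ} (hCψ : ∀ κ : ℝ, 0 < κ → κ ≤ 1 →
      ∫ t, (1 + |t|) ^ ⌈c⌉₊ * ‖cutoffFourier ψ κ t‖ ≤ Cψ * Real.exp (-(1 / (2 * κ))))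
    {R D : ℝ} (hR : 2 ≤ R) (hRD : R ≤ D) (hP : 4 * (P : ℝ) ≤ Real.log R) :
    ∑ d ∈ Icc 1 ⌊D⌋₊, (#d.divisors : ℝ) ^ A * alphaW ψ R D P d / d ≤
      K * (7 : ℝ) ^ c * Cψ * Real.exp (-(1 / 2) * (Real.log D / Real.log R)) := by
  have hR1 : 1 < R := by linarith
  have hlogR : 0 < Real.log R := Real.log_pos hR1
  have hlogD : 0 < Real.log D := Real.log_pos (by linarith)
  set κ : ℝ := Real.log R / Real.log D with hκdef
  have hκ : 0 < κ := div_pos hlogR hlogD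
  have hκ1 : κ ≤ 1 := (div_le_one hlogD).mpr (Real.log_le_log (by linarith) hRD)
  set N := ⌊R⌋₊ + 1 with hN
  set f : ℝ → ℂ := cutoffFourier ψ κ with hf
  -- each term as an integral
  set g : ℕ → ℝ → ℝ := fun d t => (#d.divisors : ℝ) ^ A * vMaj (sParam R t) P N d / d * ‖f t‖ with hg
  have hterm : ∀ d ∈ Icc 1 ⌊D⌋₊, (#d.divisors : ℝ) ^ A * alphaW ψ R D P d / d = ∫ t, g d t := by
    intro d _
    simp only [hg, alphaW]
    rw [← integral_const_mul, ← integral_div]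
    refine integral_congr_ae (ae_of_all _ fun t => ?_)
    dsimp only
    ring
  have hgi : ∀ d ∈ Icc 1 ⌊D⌋₊, Integrable (g d) := by
    intro d _
    have h := ((integrable_vMaj_mul hψ hR1 hRD P d).const_mul ((#d.divisors : ℝ) ^ A)).div_const (d : ℝ)
    refine h.congr (ae_of_all _ fun t => ?_)
    simp only [hg]
    ring
  rw [Finset.sum_congr rfl hterm, ← integral_finsetSum _ hgi]
  -- pointwise bound by `K (‖s_t‖ log R)^c |f(t)|`
  have hpt : ∀ t : ℝ, ∑ d ∈ Icc 1 ⌊D⌋₊, g d t ≤ K * (‖sParam R t‖ * Real.log R) ^ c * ‖f t‖ := by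
    intro t
    have hs : 0 ≤ (sParam R t).re := sParam_re_nonneg hR1.le t
    have hsR : (sParam R t).re * Real.log R ≤ 1 := by
      rw [sParam_re, one_div, inv_mul_cancel₀ hlogR.ne']
    have hPs : (P : ℝ) * (sParam R t).re ≤ 1 / 4 := by
      rw [sParam_re, ← div_eq_mul_one_div, div_le_iff₀ hlogR]
      linarith
    have hT : 1 ≤ ‖sParam R t‖ * Real.log R := by
      rw [norm_sParam_mul_log hR1]; exact (one_le_norm_one_add_and t).1
    have h := hF R hR (sParam R t) hs hsR hPs hT ⌊D⌋₊
    calc ∑ d ∈ Icc 1 ⌊D⌋₊, g d t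
        = (∑ d ∈ Icc 1 ⌊D⌋₊, (#d.divisors : ℝ) ^ A * vMaj (sParam R t) P N d / d) * ‖f t‖ := by
          rw [Finset.sum_mul]
      _ ≤ K * (‖sParam R t‖ * Real.log R) ^ c * ‖f t‖ := mul_le_mul_of_nonneg_right h (norm_nonneg _)
  have hint2 : Integrable fun t : ℝ => K * (‖sParam R t‖ * Real.log R) ^ c * ‖f t‖ := by
    have := (integrable_normParam_rpow_mul hψ hR1 hRD hc).const_mul K
    refine this.congr (ae_of_all _ fun t => ?_)
    simp only [hf, hκdef]
    ring
  calc ∫ t, ∑ d ∈ Icc 1 ⌊D⌋₊, g d t ≤ ∫ t, K * (‖sParam R t‖ * Real.log R) ^ c * ‖f t‖ :=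
        integral_mono (integrable_finsetSum _ hgi) hint2 hpt
    _ ≤ ∫ t, K * (7 : ℝ) ^ c * ((1 + |t|) ^ ⌈c⌉₊ * ‖f t‖) := by
        refine integral_mono hint2 ?_ fun t => ?_
        · exact ((hψ.integrable_pow_mul_norm_cutoffFourier ⌈c⌉₊ hκ hκ1).const_mul (K * (7 : ℝ) ^ c))
        · dsimp only
          obtain ⟨_, h7⟩ := one_le_norm_one_add_and t
          have ht1 : (1 : ℝ) ≤ 1 + |t| := by linarith [abs_nonneg t]
          rw [norm_sParam_mul_log hR1]
          have hpow : ‖(1 : ℂ) + 2 * π * t * Complex.I‖ ^ c ≤ (7 : ℝ) ^ c * (1 + |t|) ^ ⌈c⌉₊ := by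
            calc ‖(1 : ℂ) + 2 * π * t * Complex.I‖ ^ c ≤ (7 * (1 + |t|)) ^ c :=
                  Real.rpow_le_rpow (norm_nonneg _) h7 hc
              _ = (7 : ℝ) ^ c * (1 + |t|) ^ c := Real.mul_rpow (by norm_num) (by positivity)
              _ ≤ (7 : ℝ) ^ c * (1 + |t|) ^ ((⌈c⌉₊ : ℕ) : ℝ) := by
                  gcongr
                  exact Nat.le_ceil c
              _ = (7 : ℝ) ^ c * (1 + |t|) ^ ⌈c⌉₊ := by rw [Real.rpow_natCast]
          calc K * ‖(1 : ℂ) + 2 * π * t * Complex.I‖ ^ c * ‖f t‖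
              ≤ K * ((7 : ℝ) ^ c * (1 + |t|) ^ ⌈c⌉₊) * ‖f t‖ := by gcongr
            _ = K * (7 : ℝ) ^ c * ((1 + |t|) ^ ⌈c⌉₊ * ‖f t‖) := by ring
    _ = K * (7 : ℝ) ^ c * ∫ t, (1 + |t|) ^ ⌈c⌉₊ * ‖f t‖ := integral_const_mul _ _
    _ ≤ K * (7 : ℝ) ^ c * (Cψ * Real.exp (-(1 / (2 * κ)))) :=
        mul_le_mul_of_nonneg_left (hCψ κ hκ hκ1) (by positivity)
    _ = K * (7 : ℝ) ^ c * Cψ * Real.exp (-(1 / 2) * (Real.log D / Real.log R)) := by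
        rw [hκdef]
        have : -(1 / (2 * (Real.log R / Real.log D))) = -(1 / 2) * (Real.log D / Real.log R) := by
          field_simp
        rw [this]; ring

end Literature.Barriers.Parity.TaoTeravainen

namespace Literature.Barriers.Parity

open TaoTeravainen

/-- The divisors of `n ≠ 0` up to `D'`, as a filter of `[1, D']`. [folklore] -/
theorem TaoTeravainen.filter_Icc_dvd_eq {n : ℕ} (hn : n ≠ 0) (D' : ℕ) :
    (Icc 1 D').filter (· ∣ n) = n.divisors.filter (· ≤ D') := by
  ext d
  simp only [Finset.mem_filter, Finset.mem_Icc, Nat.mem_divisors]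
  constructor
  · rintro ⟨⟨_, h2⟩, h3⟩; exact ⟨⟨h3, hn⟩, h2⟩
  · rintro ⟨⟨h1, _⟩, h3⟩; exact ⟨⟨Nat.pos_of_dvd_of_pos h1 (Nat.pos_of_ne_zero hn), h3⟩, h1⟩

set_option maxHeartbeats 1600000 in
/-- **Tao–Teräväinen 2022, Lemma 6.1 at `k = 0` — PROVED** (discharging the named fact
`TaoTeravainen2021_lemma61`), with `ε₁ = 1`, `C = 1`, `α(d) = ∫ v_{s_t}(d)|f(t)| dt` and
`K(A) = K_A 7^{c_A} C_ψ(⌈c_A⌉)`; see the module docstring for the architecture and the thresholds.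
[cite: TaoTeravainen2021, Lemma 6.1 (with (6.1)–(6.6), §6)] -/
theorem TaoTeravainen2021_lemma61_holds : TaoTeravainen2021_lemma61 := by
  intro ℓ hℓ ψ hψ
  refine ⟨1, one_pos, fun ε₀ hε₀ hε₀1 => ?_⟩
  obtain ⟨c, hc⟩ := exists_log_le_log_conductor_add
  -- block parameters
  set J : ℕ := ⌈80 * ℓ / ε₀⌉₊ + 2 with hJdef
  set P : ℕ := J * 4 ^ (J - 1) with hPdef
  have hJ1 : 1 ≤ J := by omega
  have hP1 : 1 ≤ P := Nat.one_le_iff_ne_zero.mpr (mul_ne_zero (by omega) (pow_ne_zero _ (by norm_num)))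
  -- Euler-product data (as functions of `A`) and the decay constants of `f`
  have hEuler := fun (A : ℝ) (hA : 0 ≤ A) => exists_sum_tau_rpow_mul_vMaj_div_le hA hP1
  choose K cA hK0 hc0 hF using hEuler
  have hdecay := fun n : ℕ => hψ.integral_cutoffFourier_le n
  choose Cψ hCψ0 hCψ using hdecay
  set Kfun : ℝ → ℝ := fun A =>
    if hA : 0 ≤ A then K A hA * (7 : ℝ) ^ (cA A hA) * Cψ ⌈cA A hA⌉₊ else 0 with hKfun
  -- thresholds
  set M : ℝ := 4 * P with hMdef
  have hM4 : 4 ≤ M := by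
    have : (1 : ℝ) ≤ P := by exact_mod_cast hP1
    rw [hMdef]; linarith
  set t₀ : ℝ := max (20 * ℓ / ε₀) (4 * M) with ht₀
  have ht₀pos : 0 < t₀ := lt_max_of_lt_right (by linarith)
  set L₀ : ℝ := max (t₀ ^ (5 : ℕ)) (2 * |c|) with hL₀
  refine ⟨1, Kfun, max 10 (Real.exp L₀), ?_⟩
  intro q _ χ η hS hη x hlo hhi
  have hχ : χ.IsQuadratic := hS.2.1
  /- sizes of `η`, `q`, `x` -/
  have hη0 : 0 < η := by linarith [hS.ten_le]
  set L : ℝ := Real.log η with hLdef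
  have hL₀L : L₀ ≤ L := by
    rw [hLdef, ← Real.log_exp L₀]
    exact Real.log_le_log (Real.exp_pos _) ((le_max_right _ _).trans hη)
  have hL1 : 1 ≤ L := by
    rw [hLdef, ← Real.log_exp 1]
    refine Real.log_le_log (Real.exp_pos 1) (le_trans ?_ hS.ten_le)
    have := Real.exp_one_lt_d9; linarith
  have hL0 : 0 < L := by linarith
  have hq1' : (1 : ℝ) < q := by exact_mod_cast (lt_of_lt_of_le (by norm_num) hS.three_le : 1 < q)
  have hq0 : (0 : ℝ) < q := by linarith
  have hlogq0 : 0 ≤ Real.log q := Real.log_nonneg hq1'.le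
  have hxlo1 : (1 : ℝ) < (q : ℝ) ^ ((1 : ℝ) / 2 + ε₀) := Real.one_lt_rpow hq1' (by linarith)
  have hx1 : (1 : ℝ) < x := hxlo1.trans_le hlo
  have hx0 : (0 : ℝ) < x := by linarith
  have hxℕ : x ≠ 0 := by rintro rfl; simp at hx0
  -- `log x ≥ L/4` (Siegel (1.4): `log q ≥ L - c`, and `L ≥ 2|c|`)
  have hlogx : L / 4 ≤ Real.log x := by
    have h1 : Real.log ((q : ℝ) ^ ((1 : ℝ) / 2 + ε₀)) ≤ Real.log x := Real.log_le_log (by positivity) hlo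
    rw [Real.log_rpow hq0] at h1
    have h2 := hc q χ η hS
    have habs : c ≤ |c| := le_abs_self c
    have hcL : 2 * |c| ≤ L := (le_max_right _ _).trans hL₀L
    have hε₀q : 0 ≤ ε₀ * Real.log q := mul_nonneg hε₀.le hlogq0
    rw [← hLdef] at h2
    nlinarith
  /- the exponent `t = L^{1/5}` -/
  set t : ℝ := L ^ ((1 : ℝ) / 5) with htdef
  have ht1 : 1 ≤ t := Real.one_le_rpow hL1 (by norm_num)
  have ht0 : 0 < t := by linarith
  have ht5 : t ^ (5 : ℕ) = L := by
    rw [htdef, ← Real.rpow_natCast, ← Real.rpow_mul hL0.le]; norm_num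
  have ht₀t : t₀ ≤ t := by
    have h1 : t₀ ^ (5 : ℕ) ≤ L := (le_max_left _ _).trans hL₀L
    have h2 : (t₀ ^ (5 : ℕ)) ^ ((1 : ℝ) / 5) ≤ L ^ ((1 : ℝ) / 5) :=
      Real.rpow_le_rpow (by positivity) h1 (by norm_num)
    rwa [← Real.rpow_natCast, ← Real.rpow_mul ht₀pos.le, show ((5 : ℕ) : ℝ) * ((1 : ℝ) / 5) = 1 by norm_num,
      Real.rpow_one] at h2
  have ht20 : 20 * ℓ / ε₀ ≤ t := (le_max_left _ _).trans ht₀t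
  have ht4M : 4 * M ≤ t := (le_max_right _ _).trans ht₀t
  -- `log x ≥ t M`
  have hlogx_tM : t * M ≤ Real.log x := by
    have h1 : t * M * 4 ≤ t ^ (5 : ℕ) := by
      have ht3 : 1 ≤ t ^ 3 := one_le_pow₀ ht1
      calc t * M * 4 = t * (4 * M) * 1 := by ring
        _ ≤ t * t * t ^ 3 := by
            refine mul_le_mul (mul_le_mul_of_nonneg_left ht4M ht0.le) ht3 zero_le_one (by positivity)
        _ = t ^ (5 : ℕ) := by ring
    rw [ht5] at h1
    linarith
  have hℓ1 : (1 : ℝ) ≤ ℓ := by exact_mod_cast hℓ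
  have hℓε : (1 : ℝ) ≤ ℓ / ε₀ := by rw [le_div_iff₀ hε₀]; linarith
  have hlogx80 : 80 * ℓ / ε₀ ≤ Real.log x := by
    calc 80 * ℓ / ε₀ = (20 * ℓ / ε₀) * 4 := by ring
      _ ≤ t * M := mul_le_mul ht20 hM4 (by norm_num) ht0.le
      _ ≤ Real.log x := hlogx_tM
  /- the scales -/
  set R : ℝ := scaleR η x with hRdef
  set D : ℝ := scaleD ℓ ε₀ x with hDdef
  have hRx : R = (x : ℝ) ^ (1 / t) := rfl
  have hDx : D = (x : ℝ) ^ (ε₀ / (10 * ℓ)) := rfl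
  have hlogR : Real.log R = Real.log x / t := by
    rw [hRx, Real.log_rpow hx0]; ring
  have hlogD : Real.log D = ε₀ / (10 * ℓ) * Real.log x := by rw [hDx, Real.log_rpow hx0]
  have hR0 : 0 < R := by rw [hRx]; exact Real.rpow_pos_of_pos hx0 _
  have hD0 : 0 < D := by rw [hDx]; exact Real.rpow_pos_of_pos hx0 _
  -- `log R ≥ M = 4P ≥ 4`
  have hlogRM : M ≤ Real.log R := by
    rw [hlogR, le_div_iff₀ ht0]; linarith
  have hlogR4P : 4 * (P : ℝ) ≤ Real.log R := by rw [hMdef] at hlogRM; exact hlogRM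
  have hlogR4 : 4 ≤ Real.log R := hM4.trans hlogRM
  have hR2 : 2 ≤ R := by
    have h : Real.log 2 ≤ Real.log R := by
      have := Real.log_two_lt_d9; linarith
    exact (Real.log_le_log_iff two_pos hR0).mp h
  have hR1 : 1 < R := by linarith
  -- `log D - log R ≥ (ε₀/(20ℓ)) log x ≥ 4`
  have hgap : ε₀ / (20 * ℓ) * Real.log x ≤ Real.log D - Real.log R := by
    rw [hlogD, hlogR]
    have h1 : 1 / t ≤ ε₀ / (20 * ℓ) := by
      rw [div_le_div_iff₀ ht0 (by positivity)]
      rw [div_le_iff₀ hε₀] at ht20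
      linarith
    have hlx : 0 ≤ Real.log x := (Real.log_pos hx1).le
    have : Real.log x / t = 1 / t * Real.log x := by ring
    rw [this]
    have key : 1 / t * Real.log x ≤ ε₀ / (20 * ℓ) * Real.log x := mul_le_mul_of_nonneg_right h1 hlx
    have e : ε₀ / (10 * ℓ) * Real.log x = 2 * (ε₀ / (20 * ℓ) * Real.log x) := by
      field_simp; ring
    rw [e]
    linarith
  have hgap4 : 4 ≤ Real.log D - Real.log R := by
    refine le_trans ?_ hgap
    calc (4 : ℝ) = ε₀ / (20 * ℓ) * (80 * ℓ / ε₀) := by field_simp; ring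
      _ ≤ ε₀ / (20 * ℓ) * Real.log x := mul_le_mul_of_nonneg_left hlogx80 (by positivity)
  have hRD : R ≤ D := by
    have : Real.log R ≤ Real.log D := by linarith
    exact (Real.log_le_log_iff hR0 hD0).mp this
  have hD2 : 2 ≤ D := hR2.trans hRD
  /- the floors `B = ⌊R⌋₊`, `D' = ⌊D⌋₊` -/
  have hB2 : 2 ≤ ⌊R⌋₊ := Nat.le_floor (by exact_mod_cast hR2)
  have hB0 : (0 : ℝ) < ⌊R⌋₊ := by exact_mod_cast (show 0 < ⌊R⌋₊ by omega)
  have hBR : (⌊R⌋₊ : ℝ) ≤ R := Nat.floor_le hR0.le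
  have hD'lt : D - 1 < ⌊D⌋₊ := by have := Nat.lt_floor_add_one D; linarith
  have hD'0 : (0 : ℝ) < ⌊D⌋₊ := by linarith
  -- `log(D'/B) ≥ log D - log R - log 2`
  have hlogDB : Real.log D - Real.log R - Real.log 2 ≤ Real.log ((⌊D⌋₊ : ℝ) / ⌊R⌋₊) := by
    have h1 : D / (2 * R) ≤ (⌊D⌋₊ : ℝ) / ⌊R⌋₊ := by
      rw [div_le_div_iff₀ (by positivity) hB0]
      have h2 : D / 2 ≤ D - 1 := by linarith
      calc D * ⌊R⌋₊ ≤ D * R := mul_le_mul_of_nonneg_left hBR hD0.le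
        _ = (D / 2) * (2 * R) := by ring
        _ ≤ (⌊D⌋₊ : ℝ) * (2 * R) := by
            refine mul_le_mul_of_nonneg_right (h2.trans hD'lt.le) (by positivity)
    have h3 : Real.log (D / (2 * R)) = Real.log D - Real.log R - Real.log 2 := by
      rw [Real.log_div hD0.ne' (by positivity), Real.log_mul two_ne_zero hR0.ne']; ring
    rw [← h3]
    exact Real.log_le_log (by positivity) h1
  have hlog2 : Real.log 2 < 0.7 := by have := Real.log_two_lt_d9; linarith
  have hΛ : ε₀ / (20 * ℓ) * Real.log x - Real.log 2 ≤ Real.log ((⌊D⌋₊ : ℝ) / ⌊R⌋₊) := by linarith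
  have h4' : 4 ≤ ε₀ / (20 * ℓ) * Real.log x := by
    calc (4 : ℝ) = ε₀ / (20 * ℓ) * (80 * ℓ / ε₀) := by field_simp; ring
      _ ≤ ε₀ / (20 * ℓ) * Real.log x := mul_le_mul_of_nonneg_left hlogx80 (by positivity)
  have hΛpos : 0 < ε₀ / (20 * ℓ) * Real.log x - Real.log 2 := by linarith
  have hDB : (1 : ℝ) < (⌊D⌋₊ : ℝ) / ⌊R⌋₊ := by
    have : 0 < Real.log ((⌊D⌋₊ : ℝ) / ⌊R⌋₊) := by linarith
    exact (Real.log_pos_iff (by positivity)).mp this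
  -- `log(2x) ≤ (J-1) log(D'/B)`
  have hJreal : 80 * ℓ / ε₀ + 1 ≤ (J : ℝ) - 1 := by
    rw [hJdef]; push_cast
    have := Nat.le_ceil (80 * ℓ / ε₀)
    linarith
  have hlen : Real.log (2 * x) ≤ ((J : ℝ) - 1) * Real.log ((⌊D⌋₊ : ℝ) / ⌊R⌋₊) := by
    rw [Real.log_mul two_ne_zero hx0.ne']
    have h1 : (80 * ℓ / ε₀ + 1) * (ε₀ / (20 * ℓ) * Real.log x - Real.log 2) ≤
        ((J : ℝ) - 1) * Real.log ((⌊D⌋₊ : ℝ) / ⌊R⌋₊) :=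
      mul_le_mul hJreal hΛ hΛpos.le (by
        have : (0 : ℝ) ≤ 80 * ℓ / ε₀ + 1 := by positivity
        linarith)
    have h2 : (80 * ℓ / ε₀ + 1) * (ε₀ / (20 * ℓ) * Real.log x - Real.log 2) =
        4 * Real.log x + ε₀ / (20 * ℓ) * Real.log x - (80 * ℓ / ε₀ + 1) * Real.log 2 := by
      field_simp; ring
    have h3 : (80 * ℓ / ε₀ + 1) * Real.log 2 ≤ 0.7 * (80 * ℓ / ε₀ + 1) := by
      have : 0 ≤ 80 * ℓ / ε₀ + 1 := by positivity
      nlinarith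
    have h4 : 0 ≤ ε₀ / (20 * ℓ) * Real.log x := by
      have := (Real.log_pos hx1).le; positivity
    nlinarith
  /- the weights -/
  refine ⟨alphaW ψ R D P, fun d => alphaW_nonneg ψ hR1.le D P d, ?_, ?_⟩
  · -- (6.4)
    intro n hn1 hn2x
    have hn0 : n ≠ 0 := by omega
    have hn0' : (0 : ℝ) < n := by exact_mod_cast hn1
    have hlen_n : Real.log n ≤ ((J : ℝ) - 1) * Real.log ((⌊D⌋₊ : ℝ) / ⌊R⌋₊) :=
      (Real.log_le_log hn0' hn2x).trans hlen
    rw [liouvilleSiegel_sub_liouvilleSiegelSharp χ hχ ψ R D hn0, one_mul,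
      TaoTeravainen.filter_Icc_dvd_eq hn0]
    exact abs_liouvilleSiegelFlat_le_sum_alphaW χ hχ hψ hR1 hRD hJ1 hDB hn0 hlen_n
  · -- (6.6)
    intro A hA1
    have hA0 : 0 ≤ A := by linarith
    have h := sum_tau_rpow_mul_alphaW_div_le hψ (P := P) (hK0 A hA0) (hc0 A hA0) (hF A hA0)
      (hCψ ⌈cA A hA0⌉₊) hR2 hRD hlogR4P
    have hKA : Kfun A = K A hA0 * (7 : ℝ) ^ (cA A hA0) * Cψ ⌈cA A hA0⌉₊ := by
      simp only [hKfun, dif_pos hA0]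
    rw [hKA]
    refine h.trans (mul_le_mul_of_nonneg_left (Real.exp_le_exp.mpr ?_) ?_)
    · have : 0 ≤ Real.log D / Real.log R := div_nonneg (Real.log_nonneg (by linarith)) (by linarith)
      nlinarith
    · have := hK0 A hA0; have := hCψ0 ⌈cA A hA0⌉₊; positivity

end Literature.Barriers.Parity
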